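import Summits.BirchSwinnertonDyer.BirchSwinnertonDyer.Theorems.GenusKolyvaginAtTwoGenusPrimitiveSupplyAtTwoPrimeHeegnerTwinDichotomy
import Literature.NumberTheory.QuadraticFields.FundamentalDiscriminant
import HarnessLib

/-!
# Route `GenusKolyvaginAtTwo`, crux `GenusPrimitiveSupplyAtTwo` (stmt-BirchSwinnertonDyer-22136):
# the DEF = 1 supply on WALL row 1 (`dim Sel₂(E) = 2`) reduced to ONE displayed twisting prime

Seat `bsd-line-gk2-p5` g6 (cell `bsd-f1-sign2`), SUPPLY lineage; fifth file of the g6 series. Summit-side THEOREM-ONLY file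
(no definition, no named fact, no `sorry`), `--supports stmt-BirchSwinnertonDyer-22136`, route-independent imports.

CONTEXT. On the habitat cells of WALL row 1 `dim_𝔽₂ Sel₂(E) = 2` throughout (gk2-p4 g6 FINDING #2: 591/591), so the DEF = 1 supply
of a Sel₂-MINIMAL twin is not free there: by `…PrimeHeegnerTwinDichotomy.natCard_selmerGroup_twin_eq_two_iff_not_strict` the prime
Heegner twin `E^{(−ℓ)}` is minimal iff `Sel₂(E)` is NOT strict at `ℓ` (Mazur–Rubin's `V_T ≠ 0`). THIS FILE turns that into a
supply statement whose ONLY non-print input is ONE displayed prime: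

* §1 `exists_heegnerField_of_prime` — from a prime `ℓ ≡ 7 (mod 8)` with `ℓ ≡ −1 (mod p)` for every odd `p ∣ N_W` (no Dirichlet
  here: `ℓ` is GIVEN), the field `K = ℚ(√−ℓ)` with every K-clause of crux 22136 (imaginary quadratic, `d_K = −ℓ` odd `≠ −3`, Heegner
  for `N_W`, the two non-square clauses) and `2` split; `ℓ ∤ N_W`, `ℓ ∤ Δ_min(W)`.
* §2 `supply_DEF1_of_not_strict_prime` (mod `MazurRubin2010.cor34i_singleton_rat`, PRINT): `W` globally minimal elliptic with
  `Δ_W < 0` and `#Sel₂(W) = 4`; a prime `ℓ` as in §1 at which `Sel₂(W)` is NOT strict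
  (`¬ W.selmerGroup 2 ≤ MazurRubin2010.strictLocalKer W ℚ_[ℓ] 2`) ⟹ the DEF = 1 admissible field `K = ℚ(√−ℓ)` AND a globally
  minimal twin `Wd ≅ W^{(−ℓ)}` with `#Sel₂(Wd) = 2`. So on row 1 the whole of SUPPLY″-Selmer is the EXISTENCE of such an `ℓ`
  — Mazur–Rubin's twisting prime (2010, §3: Čebotarev in `ℚ(E[2])·(field of a Selmer class)·ℚ(ζ_{8N})`), to be typed as ONE
  print/Čebotarev input; and `supply_DEF1_of_strict_free_prime` records the `#Sel₂(W) = 1` companion (any such `ℓ`, mod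
  `prop33_rat`).

References: [MazurRubin2010] Def. 3.1, Prop. 3.3, Cor. 3.4 (i); [GrossLMS1991] §1; [Cox2013] §1 (decomposition law). No item is
closed by this file; BSD is not proved by any of this.
-/

set_option linter.dupNamespace false -- tree convention: `Summit.BirchSwinnertonDyer.BirchSwinnertonDyer.Theorems` (summit = sub-problem)
set_option autoImplicit false

noncomputable section

open scoped Classical

open NumberField WeierstrassCurve Literature.NumberTheory.EllipticCurves Literature.NumberTheory.QuadraticFields

namespace Summit.BirchSwinnertonDyer.BirchSwinnertonDyer.Theorems.GenusKolyTwin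

variable (W : WeierstrassCurve ℚ) [W.IsElliptic] [W.IsGloballyMinimal]

/-! ## §1. The Heegner field `ℚ(√−ℓ)` of a GIVEN prime `ℓ ≡ 7 (mod 8)`, `ℓ ≡ −1 (mod p ∣ N_W)` -/

omit [W.IsGloballyMinimal] in
/-- A nonzero rational with ODD `q`-adic valuation at some prime `q` is not a square in `ℚ`. [folklore] -/
private theorem not_isSquare_of_padicValRat_odd' {q : ℕ} [Fact q.Prime] {x : ℚ} (hx : x ≠ 0)
    (hodd : Odd (padicValRat q x)) : ¬ IsSquare x := by
  rintro ⟨y, rfl⟩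
  have hy : y ≠ 0 := fun h => hx (by rw [h, mul_zero])
  rw [padicValRat.mul hy hy, ← two_mul] at hodd
  exact (Int.not_odd_iff_even.mpr (even_two_mul _)) hodd

/-- **The Heegner field of a given prime.** For `W/ℚ` globally minimal elliptic and a prime `ℓ ≡ 7 (mod 8)` with `ℓ ≡ −1 (mod p)`
for every odd prime `p ∣ N_W`: `ℓ ∤ N_W`, `ℓ ∤ Δ_min(W)`, and there is a number field `K` (`= ℚ(√−ℓ)`) with `d_K = −ℓ`, imaginary
quadratic, `d_K` odd and `≠ −3`, satisfying the Heegner hypothesis for `N_W` (odd `p ∣ N_W`: `(−ℓ/p) = (1/p) = 1`; `p = 2`: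
`−ℓ ≡ 1 (mod 8)`), with `2` split, and with `d_K·(−|Δ_W|)`, `d_K·(−2|Δ_W|)` non-squares (their `ℓ`-adic valuation is `1`).
[cite: GrossLMS1991, §1 (p. 235)] [cite: Cox2013, §1] -/
theorem exists_heegnerField_of_prime {ℓ : ℕ} (hℓ : ℓ.Prime) (hℓ8 : ℓ % 8 = 7)
    (hℓN : ∀ p : ℕ, p.Prime → p ∣ W.conductorNorm ℤ → p ≠ 2 → (ℓ : ZMod p) = -1) :
    ¬ ℓ ∣ W.conductorNorm ℤ ∧ ¬ (ℓ : ℤ) ∣ minimalDiscriminantInt W ∧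
    ∃ (K : Type) (_ : Field K) (_ : NumberField K), IsImaginaryQuadratic K ∧ discr K = -(ℓ : ℤ) ∧ Odd (discr K) ∧
      discr K ≠ -3 ∧ SatisfiesHeegnerHypothesis (W.conductorNorm ℤ) K ∧
      ((Ideal.span {(2 : ℤ)}).primesOver (𝓞 K)).ncard = 2 ∧
      ¬ IsSquare ((discr K : ℚ) * -|W.Δ|) ∧ ¬ IsSquare ((discr K : ℚ) * (-(2 * |W.Δ|))) := by
  haveI := Fact.mk hℓ
  have hℓ2 : ℓ ≠ 2 := by omega
  -- `ℓ ∤ N_W`: otherwise `ℓ ≡ −1 (mod ℓ)`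
  have hℓN' : ¬ ℓ ∣ W.conductorNorm ℤ := by
    intro h
    have h0 : ((ℓ : ℕ) : ZMod ℓ) = -1 := hℓN ℓ hℓ h hℓ2
    rw [ZMod.natCast_self] at h0
    exact one_ne_zero (neg_eq_zero.mp h0.symm)
  have hℓΔ : ¬ (ℓ : ℤ) ∣ minimalDiscriminantInt W := fun h =>
    hℓN' (dvd_conductorNorm_of_dvd_minimalDiscriminantInt W hℓ h)
  -- the field `ℚ(√−ℓ)`
  have hD : ((-(ℓ : ℤ)) % 4 = 1 ∧ Squarefree (-(ℓ : ℤ)) ∧ -(ℓ : ℤ) ≠ 1) ∨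
      (4 ∣ -(ℓ : ℤ) ∧ (-(ℓ : ℤ) / 4 % 4 = 2 ∨ -(ℓ : ℤ) / 4 % 4 = 3) ∧ Squarefree (-(ℓ : ℤ) / 4)) := by
    refine Or.inl ⟨by omega, ?_, by omega⟩
    rw [← Int.squarefree_natAbs]
    simpa using hℓ.squarefree
  obtain ⟨K, _, _, h2, hdisc⟩ := Quadratic.exists_numberField_discr_eq hD
  have hK : IsImaginaryQuadratic K :=
    ⟨h2, Quadratic.isTotallyComplex_of_discr_neg h2 (by rw [hdisc, neg_lt_zero]; exact_mod_cast hℓ.pos)⟩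
  have hH : SatisfiesHeegnerHypothesis (W.conductorNorm ℤ) K := by
    intro p hp hpN
    by_cases hp2 : p = 2
    · subst hp2
      exact_mod_cast Quadratic.ncard_primesOver_two_eq_two_of_discr_eq_neg h2 hdisc hℓ8
    · exact Quadratic.ncard_primesOver_eq_two_of_discr_eq_neg h2 hdisc hp hp2 (hℓN p hp hpN hp2)
  have h2split : ((Ideal.span {(2 : ℤ)}).primesOver (𝓞 K)).ncard = 2 := by
    exact_mod_cast Quadratic.ncard_primesOver_two_eq_two_of_discr_eq_neg h2 hdisc hℓ8
  -- `ℓ`-adic valuations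
  have hℓQ : (ℓ : ℚ) ≠ 0 := by exact_mod_cast hℓ.ne_zero
  have hΔQ : (W.Δ : ℚ) ≠ 0 := W.isUnit_Δ.ne_zero
  have hvΔ : padicValRat ℓ W.Δ = 0 := by
    rw [← cast_minimalDiscriminantInt W, padicValRat.of_int, Int.natCast_eq_zero, padicValInt.eq_zero_of_not_dvd hℓΔ]
  have hvΔabs : padicValRat ℓ |W.Δ| = 0 := by
    rcases abs_choice W.Δ with h | h
    · rw [h, hvΔ]
    · rw [h, padicValRat.neg, hvΔ]
  have hv2 : padicValRat ℓ (2 : ℚ) = 0 := by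
    have h2' : ¬ ℓ ∣ 2 := fun h => by have := Nat.le_of_dvd two_pos h; omega
    rw [show (2 : ℚ) = ((2 : ℕ) : ℚ) by norm_num, padicValRat.of_nat, padicValNat.eq_zero_of_not_dvd h2', Nat.cast_zero]
  have hy0 : (ℓ : ℚ) * |W.Δ| ≠ 0 := mul_ne_zero hℓQ (abs_ne_zero.mpr hΔQ)
  have hy : padicValRat ℓ ((ℓ : ℚ) * |W.Δ|) = 1 := by
    rw [padicValRat.mul hℓQ (abs_ne_zero.mpr hΔQ), padicValRat.self hℓ.one_lt, hvΔabs, add_zero]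
  refine ⟨hℓN', hℓΔ, K, inferInstance, inferInstance, hK, hdisc, by rw [hdisc, Int.odd_iff]; omega, by rw [hdisc]; omega, hH,
    h2split, ?_, ?_⟩
  · have hx : ((discr K : ℤ) : ℚ) * -|W.Δ| = (ℓ : ℚ) * |W.Δ| := by rw [hdisc]; push_cast; ring
    rw [hx]
    exact not_isSquare_of_padicValRat_odd' (q := ℓ) hy0 (by rw [hy]; exact odd_one)
  · have hx : ((discr K : ℤ) : ℚ) * (-(2 * |W.Δ|)) = 2 * ((ℓ : ℚ) * |W.Δ|) := by rw [hdisc]; push_cast; ring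
    rw [hx]
    refine not_isSquare_of_padicValRat_odd' (q := ℓ) (mul_ne_zero two_ne_zero hy0) ?_
    rw [padicValRat.mul two_ne_zero hy0, hy, hv2, zero_add]
    exact odd_one

/-! ## §2. Row 1: the DEF = 1 Sel₂-minimal twin from ONE non-strict twisting prime -/

/-- **SUPPLY″-Selmer on the `#Sel₂(E) = 4` cells (WALL row 1) from ONE displayed twisting prime** (mod the PRINT named fact
`MazurRubin2010.cor34i_singleton_rat`). Let `W/ℚ` be globally minimal elliptic with `Δ_W < 0` and `#Sel₂(W) = 4`, and let `ℓ` be a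
prime with `ℓ ≡ 7 (mod 8)`, `ℓ ≡ −1 (mod p)` for every odd prime `p ∣ N_W`, at which `Sel₂(W)` is NOT strict
(`¬ Sel₂(W) ≤ ker loc_ℓ`, Mazur–Rubin's `V_{{ℓ}} ≠ 0`). Then `K = ℚ(√−ℓ)` carries every K-clause of crux 22136, `2` splits,
DEF(W,K) = 1 (the `2`-division cubic has exactly one root mod `ℓ`), and the twist has a GLOBALLY MINIMAL model `Wd ≅ W^{(−ℓ)}` with
`#Sel₂(Wd) = 2`. The existence of such an `ℓ` (Mazur–Rubin 2010 §3, Čebotarev) is the one input not supplied here.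
[cite: MazurRubin2010, Cor. 3.4 (i) with Def. 3.1] [cite: GrossLMS1991, §1 (p. 235)] -/
theorem supply_DEF1_of_not_strict_prime (h34 : MazurRubin2010.cor34i_singleton_rat) (hΔ : W.Δ < 0)
    (h4 : Nat.card (W.selmerGroup 2) = 4) {ℓ : ℕ} [Fact ℓ.Prime] (hℓ8 : ℓ % 8 = 7)
    (hℓN : ∀ p : ℕ, p.Prime → p ∣ W.conductorNorm ℤ → p ≠ 2 → (ℓ : ZMod p) = -1)
    (hns : ¬ W.selmerGroup 2 ≤ MazurRubin2010.strictLocalKer W ℚ_[ℓ] 2) :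
    ∃ (K : Type) (_ : Field K) (_ : NumberField K), IsImaginaryQuadratic K ∧ discr K = -(ℓ : ℤ) ∧ Odd (discr K) ∧
      discr K ≠ -3 ∧ SatisfiesHeegnerHypothesis (W.conductorNorm ℤ) K ∧
      ¬ IsSquare ((discr K : ℚ) * -|W.Δ|) ∧ ¬ IsSquare ((discr K : ℚ) * (-(2 * |W.Δ|))) ∧
      ((Ideal.span {(2 : ℤ)}).primesOver (𝓞 K)).ncard = 2 ∧
      (∃! x : ZMod ℓ, 4 * x ^ 3 + ((integralModelInt W).b₂ : ZMod ℓ) * x ^ 2 +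
        2 * ((integralModelInt W).b₄ : ZMod ℓ) * x + ((integralModelInt W).b₆ : ZMod ℓ) = 0) ∧
      ∃ (Wd : WeierstrassCurve ℚ) (_ : Wd.IsElliptic) (_ : Wd.IsGloballyMinimal),
        (∃ C : VariableChange ℚ, C • W.quadraticTwist (discr K : ℚ) = Wd) ∧ Nat.card (Wd.selmerGroup 2) = 2 := by
  have hℓ : ℓ.Prime := Fact.out
  obtain ⟨-, -, K, _, _, hK, hd, hodd, hd3, hH, h2K, hsq1, hsq2⟩ := exists_heegnerField_of_prime W hℓ hℓ8 hℓN
  -- a globally minimal model of the twist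
  have hd0 : ((discr K : ℤ) : ℚ) ≠ 0 := by exact_mod_cast NumberField.discr_ne_zero K
  haveI := W.isElliptic_quadraticTwist hd0
  obtain ⟨C, hC⟩ := hasGlobalMinimalModel_rat_holds (W.quadraticTwist ((discr K : ℤ) : ℚ))
  haveI := hC
  refine ⟨K, inferInstance, inferInstance, hK, hd, hodd, hd3, hH, hsq1, hsq2, h2K,
    existsUnique_zmod_root_of_discr_eq_neg_prime_of_Δ_neg W hK hodd hH hd hΔ,
    C • W.quadraticTwist ((discr K : ℤ) : ℚ), inferInstance, hC, ⟨C, rfl⟩, ?_⟩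
  exact (natCard_selmerGroup_twin_eq_two_iff_not_strict W h34 hΔ hK hodd hH h2K hd _ ⟨C, rfl⟩ h4).mpr hns

/-- **Companion on `#Sel₂(E) = 1`**: there EVERY prime `ℓ ≡ 7 (mod 8)`, `ℓ ≡ −1 (mod p ∣ N_W)` works (mod `prop33_rat`) — no
strictness condition, so the Čebotarev input degenerates to Dirichlet (cf. `exists_prime_heegnerField_minimalTwin_of_prop33`).
[cite: MazurRubin2010, Prop. 3.3 and Cor. 3.4 (i)] -/
theorem supply_DEF1_of_strict_free_prime (h33 : MazurRubin2010.prop33_rat) (hΔ : W.Δ < 0)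
    (h1 : Nat.card (W.selmerGroup 2) = 1) {ℓ : ℕ} (hℓ : ℓ.Prime) (hℓ8 : ℓ % 8 = 7)
    (hℓN : ∀ p : ℕ, p.Prime → p ∣ W.conductorNorm ℤ → p ≠ 2 → (ℓ : ZMod p) = -1) :
    ∃ (K : Type) (_ : Field K) (_ : NumberField K), IsImaginaryQuadratic K ∧ discr K = -(ℓ : ℤ) ∧ Odd (discr K) ∧
      discr K ≠ -3 ∧ SatisfiesHeegnerHypothesis (W.conductorNorm ℤ) K ∧
      ¬ IsSquare ((discr K : ℚ) * -|W.Δ|) ∧ ¬ IsSquare ((discr K : ℚ) * (-(2 * |W.Δ|))) ∧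
      ((Ideal.span {(2 : ℤ)}).primesOver (𝓞 K)).ncard = 2 ∧
      ∃ (Wd : WeierstrassCurve ℚ) (_ : Wd.IsElliptic) (_ : Wd.IsGloballyMinimal),
        (∃ C : VariableChange ℚ, C • W.quadraticTwist (discr K : ℚ) = Wd) ∧ Nat.card (Wd.selmerGroup 2) = 2 := by
  obtain ⟨-, -, K, _, _, hK, hd, hodd, hd3, hH, h2K, hsq1, hsq2⟩ := exists_heegnerField_of_prime W hℓ hℓ8 hℓN
  have hd0 : ((discr K : ℤ) : ℚ) ≠ 0 := by exact_mod_cast NumberField.discr_ne_zero K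
  haveI := W.isElliptic_quadraticTwist hd0
  obtain ⟨C, hC⟩ := hasGlobalMinimalModel_rat_holds (W.quadraticTwist ((discr K : ℤ) : ℚ))
  haveI := hC
  refine ⟨K, inferInstance, inferInstance, hK, hd, hodd, hd3, hH, hsq1, hsq2, h2K,
    C • W.quadraticTwist ((discr K : ℤ) : ℚ), inferInstance, hC, ⟨C, rfl⟩, ?_⟩
  exact natCard_selmerGroup_twin_eq_two_of_prime_heegner W h33 hΔ hK hodd hH h2K hℓ hd _ ⟨C, rfl⟩ h1

end Summit.BirchSwinnertonDyer.BirchSwinnertonDyer.Theorems.GenusKolyTwin
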